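import Literature.AnabelianGeometry.AbsoluteAnabelian.AbsTopII.InertiaGroups
import Literature.AnabelianGeometry.SemiGraphs.OncePuncturedTemperedGroupWitness
import Literature.IUT.HodgeTheaters.ZHatIntegersInjective
import HarnessLib

/-!
# [AbsTopII] §1 (Def 1.1 / 1.2, Prop 1.3 (x)): the interfaces `AbsTopII.DPSCIndexData` and
# `AbsTopII.DPSCIndexData.LogPointData` are inhabited — the ABSTRACT TRIPOD (abc-iut-w5-d197, gen 2)

S. Mochizuki, *Topics in absolute anabelian geometry II: decomposition groups and endomorphisms*,
J. Math. Sci. Univ. Tokyo 20 (2013) [AbsTopII], §1: the data of a DPSC-pair `Π_𝔾 ⊆ Π_I ⊆ Π_H` with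
the verticial / edge-like subgroups of the pointed stable curve `𝔾` (abc-iut-L4-t6's `DPSCData`,
`DecompositionGroups.lean`), the `Σ`-indices of the nodes (`DPSCIndexData`, `InertiaGroups.lean`) and
the sections `τ_I` of the log point (Prop 1.3 (x) p. 12, `DPSCIndexData.LogPointData`).  The rows
`DPSCIndexData`, `DPSCIndexData.LogPointData` read ZERO producers (and `DPSCData` no closed producer)
in the L4 inhabitation census v2 (05:58Z).  This PROOF-ONLY file (no `def`/`instance`/`structure`)
records the ABSTRACT TRIPOD:

* `Π_H = Π_I = Π_𝔾 := F̂₂`, the profinite completion of the free group on `a, b` (so `H = I = 1`: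
  no log structure on the base, trivial inertia quotient);
* ONE vertex `v` with `Π_v := Π_𝔾` (irreducible special fibre), NO nodes;
* THREE cusps `0, 1, 2` with cuspidal subgroups the closed procyclic subgroups topologically generated
  by `η(a)`, `η(b)`, `η((ab)⁻¹)` (`η : F₂ → F̂₂`), all abutting to `v`; `abc = 1` for the three
  generators;
* `Σ :=` all primes (no node, so no `Σ`-index to record);
* the log-point datum `τ_I(I) := 1` (the unique section of `Π_I ↠ I = 1`), of kind "smooth point of `v`".

HONEST LABEL: by Riemann's existence theorem — NOT in the tree — `F̂₂` with these three conjugacy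
classes of procyclic subgroups IS `π̂₁` of the thrice-punctured projective line over an algebraically
closed field of characteristic zero with its cuspidal inertia groups (type `(0,3)`); inside the tree
it is an abstract-group model.  The witness shows the typed records are jointly satisfiable by a
non-degenerate profinite datum (non-abelian free `Π_𝔾`, three distinct non-trivial cuspidal
subgroups); it asserts nothing of [AbsTopII] Prop 1.3.  No side taken on [IUTchIII] Cor 3.12; a
witness is consistency evidence, not an endorsement; typed ≠ proved.
-/

namespace Literature.AnabelianGeometry.AbsoluteAnabelian.AbsTopII

open _root_.Topology _root_.CategoryTheory
open Literature.IUT.HodgeTheaters (profiniteCompletion toCompletion toCompletion_int_injective)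
open Literature.AnabelianGeometry.SemiGraphs (lift_hom_toCompletion)

/-- **[AbsTopII] §1 — the abstract tripod inhabits `DPSCIndexData` and `LogPointData`.**  There is
`X : DPSCIndexData` with `Π_H = F̂₂`, `Π_𝔾 = Π_I = Π_H`, vertices `≃ Unit`, no nodes, cusps `Fin 3`
whose cuspidal subgroups are the closures of `⟨η a⟩`, `⟨η b⟩`, `⟨η (ab)⁻¹⟩` (with `a · b · (ab)⁻¹ = 1`),
`Σ` = all primes, and an inhabitant of `X.LogPointData` (the trivial section).  Honest label: abstract
tripod (Riemann existence not in the tree). [cite: MochizukiAbsTopII2013, Def 1.2 (ii) p.10] -/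
theorem DPSCIndexData.exists_tripod :
    ∃ X : DPSCIndexData.{0},
      X.PiH = profiniteCompletion (FreeGroup (Fin 2)) ∧ X.PiG = ⊤ ∧ X.PiI = ⊤ ∧
      Nonempty (X.Vert ≃ Unit) ∧ IsEmpty X.Node ∧ Nonempty (X.Cusp ≃ Fin 3) ∧
      X.Sigma = {l | l.Prime} ∧ (∀ v, X.vertSub v = ⊤) ∧
      (∃ g : X.Cusp → X.PiH, (∀ e, X.cuspSub e = (Subgroup.zpowers (g e)).topologicalClosure) ∧
        (∀ e, g e ≠ 1) ∧ ∃ e₀ e₁ e₂ : X.Cusp, e₀ ≠ e₁ ∧ e₁ ≠ e₂ ∧ e₀ ≠ e₂ ∧ g e₀ * g e₁ * g e₂ = 1) ∧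
      Nonempty X.LogPointData := by
  classical
  let P : ProfiniteGrp.{0} := profiniteCompletion (FreeGroup (Fin 2))
  let η : FreeGroup (Fin 2) →* P := toCompletion (FreeGroup (Fin 2))
  let a : FreeGroup (Fin 2) := FreeGroup.of 0
  let b : FreeGroup (Fin 2) := FreeGroup.of 1
  -- the three cusp generators `a, b, (ab)⁻¹`
  let gen : Fin 3 → FreeGroup (Fin 2) := ![a, b, (a * b)⁻¹]
  -- `η` is non-trivial on each generator: the completed exponent sums detect `a` and `b`
  let Zh : ProfiniteGrp.{0} := profiniteCompletion (Multiplicative ℤ)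
  let ι : Multiplicative ℤ →* Zh := toCompletion (Multiplicative ℤ)
  let σa : FreeGroup (Fin 2) →* Multiplicative ℤ :=
    FreeGroup.lift fun j => if j = (0 : Fin 2) then Multiplicative.ofAdd (1 : ℤ) else 1
  let σb : FreeGroup (Fin 2) →* Multiplicative ℤ :=
    FreeGroup.lift fun j => if j = (1 : Fin 2) then Multiplicative.ofAdd (1 : ℤ) else 1
  let ea : P →ₜ* Zh := (ProfiniteGrp.ProfiniteCompletion.lift (GrpCat.ofHom (ι.comp σa))).hom
  let eb : P →ₜ* Zh := (ProfiniteGrp.ProfiniteCompletion.lift (GrpCat.ofHom (ι.comp σb))).hom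
  have hea : ∀ g, ea (η g) = ι (σa g) := fun g => lift_hom_toCompletion Zh (ι.comp σa) g
  have heb : ∀ g, eb (η g) = ι (σb g) := fun g => lift_hom_toCompletion Zh (ι.comp σb) g
  have hιinj : Function.Injective ι := toCompletion_int_injective
  have hι1 : ι (Multiplicative.ofAdd 1) ≠ 1 := by
    rw [← map_one ι]; exact fun h => absurd (hιinj h) (by decide)
  have hιm1 : ι (Multiplicative.ofAdd (-1)) ≠ 1 := by
    rw [← map_one ι]; exact fun h => absurd (hιinj h) (by decide)
  have hσaa : σa a = Multiplicative.ofAdd 1 := by simp [σa, a]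
  have hσbb : σb b = Multiplicative.ofAdd 1 := by simp [σb, b]
  have hσac : σa (a * b)⁻¹ = Multiplicative.ofAdd (-1) := by
    rw [map_inv, map_mul]; simp [σa, a, b]
  have hηa : η a ≠ 1 := fun h => hι1 (by rw [← hσaa, ← hea a, h, map_one])
  have hηb : η b ≠ 1 := fun h => hι1 (by rw [← hσbb, ← heb b, h, map_one])
  have hηc : η (a * b)⁻¹ ≠ 1 := fun h => hιm1 (by rw [← hσac, ← hea (a * b)⁻¹, h, map_one])
  let X : DPSCIndexData.{0} :=
    { PiH := P
      PiG := ⊤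
      normal_PiG := inferInstance
      isClosed_PiG := by rw [Subgroup.coe_top]; exact isClosed_univ
      PiI := ⊤
      PiG_le_PiI := le_rfl
      normal_PiI := inferInstance
      Vert := Unit
      Node := PEmpty
      Cusp := Fin 3
      vertSub := fun _ => ⊤
      vertSub_le := fun _ => le_rfl
      nodeSub := fun e => e.elim
      nodeSub_le := fun e => e.elim
      cuspSub := fun e => (Subgroup.zpowers (η (gen e))).topologicalClosure
      cuspSub_le := fun _ => le_top
      nodeAbuts := fun e => e.elim
      cuspVert := fun _ => ()
      Sigma := {l | l.Prime}
      sigma_prime := ⟨⟨2, Nat.prime_two⟩, fun _ hl => hl⟩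
      sigmaIndex := fun e => e.elim
      sigmaIndex_isSigmaInteger := fun e => e.elim }
  have hτ : Nonempty X.LogPointData :=
    ⟨{ image := ⊥
       image_le := bot_le
       isClosed_image := by
         change IsClosed (((⊥ : Subgroup P) : Set P))
         rw [Subgroup.coe_bot]; exact isClosed_singleton
       image_inf := bot_inf_eq _
       image_sup := by change (⊥ : Subgroup P) ⊔ ⊤ = ⊤; exact bot_sup_eq _
       kind := PointKind.smooth () }⟩
  refine ⟨X, rfl, rfl, rfl, ⟨Equiv.refl _⟩, (inferInstance : IsEmpty PEmpty), ⟨Equiv.refl _⟩, rfl,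
    fun _ => rfl, ⟨fun e => η (gen e), fun _ => rfl, ?_, (0 : Fin 3), 1, 2, by decide, by decide,
      by decide, ?_⟩, hτ⟩
  · intro e
    fin_cases e
    · exact hηa
    · exact hηb
    · exact hηc
  · change η a * η b * η (a * b)⁻¹ = 1
    rw [← map_mul, ← map_mul, mul_inv_cancel, map_one]

/-- COROLLARY: the parent record `DPSCData` ([AbsTopII] Def 1.1 / 1.2) has a closed inhabitant (the
tripod's underlying datum). [cite: MochizukiAbsTopII2013, Def 1.2 (ii) p.10] -/
theorem DPSCIndexData.nonempty_dpscData_tripod :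
    ∃ D : DPSCData.{0}, D.PiH = profiniteCompletion (FreeGroup (Fin 2)) ∧ Nonempty (D.Cusp ≃ Fin 3) := by
  obtain ⟨X, hP, -, -, -, -, hC, -⟩ := DPSCIndexData.exists_tripod
  exact ⟨X.toDPSCData, hP, hC⟩

/-- COROLLARY: `DPSCIndexData` and its `LogPointData` are jointly inhabited.
[cite: MochizukiAbsTopII2013, Prop 1.3 (x) p.12] -/
theorem DPSCIndexData.nonempty_sigma_logPointData :
    ∃ X : DPSCIndexData.{0}, Nonempty X.LogPointData := by
  obtain ⟨X, -, -, -, -, -, -, -, -, -, hτ⟩ := DPSCIndexData.exists_tripod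
  exact ⟨X, hτ⟩

end Literature.AnabelianGeometry.AbsoluteAnabelian.AbsTopII
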